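import Literature.Dynamics.Contraction.GramArea
import HarnessLib

/-!
# The area dilation `ω₂(L)` of a bounded operator (the norm of `Λ² L` on decomposable 2-vectors)

Topic `Literature/Dynamics/Contraction`; companion to `AdditiveCompound.lean` (`secondAdditiveCompound`,
`logNorm`) and `GramArea.lean` (`gramArea x y = |x ∧ y|²`, decay of 2-volumes along `ẋ = A(t) x`),
completing definition request `defn-SecondAdditiveCompound` (route
`Summits/NavierStokesRegularity/…/DulacContraction`, support item `RelativeContractionEngine` =
stmt-NavierStokesRegularity-8569) with the one notion its grounder still reported missing
(note of 2026-08-15 on that item): the number `ω₂(L)` measuring **the largest dilation of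
2-dimensional areas** by a bounded linear map `L`, in which "the cocycle is uniformly 2-contracting,
`ω₂(DΦ_s(x)) ≤ c e^{-ηs}`" is stated.

**Sources.**  R. Temam, *Infinite-Dimensional Dynamical Systems in Mechanics and Physics*
(Springer, 2nd ed. 1997), Ch. V: §1.1 (1.16) (`|φ₁ ∧ φ₂| ≤ |φ₁| |φ₂|`); §1.2.1 (1.17)–(1.20): the
operator `Λ^m L (φ₁, …, φ_m) = Lφ₁ ∧ ⋯ ∧ Lφ_m`, its norm as an `m`-linear operator
`‖Λ^m L‖_{ℒ_m(E^m, Λ^m E)} = sup_{|φᵢ| ≤ 1} |Lφ₁ ∧ ⋯ ∧ Lφ_m|` (1.19) and the bound `≤ ‖L‖^m` (1.20);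
(1.23)–(1.24) `ω_m(L) = α₁(L) ⋯ α_m(L)`; Proposition 1.4 (1.56): `ω_m(L)` EQUALS the norm of `Λ^m L`
in `ℒ(Λ^m E)` and the `m`-linear norm (1.19); Corollary 1.1 (1.60): `ω_m(L L') ≤ ω_m(L) ω_m(L')`, and
`ω_m(Lⁿ) ≤ ω_m(L)ⁿ` (§2.3, footnote to (2.45)); §2.1 (2.7)–(2.8): `ω_m(L)` is the largest ratio
`|Lξ₁ ∧ ⋯ ∧ Lξ_m| / |ξ₁ ∧ ⋯ ∧ ξ_m|`, "the largest distortion of an infinitesimal `m`-dimensional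
volume".  N. V. Kuznetsov, V. Reitmann, *Attractor Dimension Estimates for Dynamical Systems*
(Springer, 2021), §2.1.2 (2.3)–(2.4) (singular value function `ω_k(A) = α₁ ⋯ α_k`), Lemma 2.4 (Horn:
`[(P uᵢ, uⱼ)] ≤ ω_k(P)² [(uᵢ, uⱼ)]`, the Gram-determinant form) and Proposition 2.4 (2.15) (Horn's
inequality `ω_d(AB) ≤ ω_d(A) ω_d(B)`); §6.1 (`ω_d(Dφᵗ(u))` along a flow).  C. Wu, I. Kanevskiy,
M. Margaliot, *`k`-contraction: theory and applications*, arXiv:2008.10321, §3.1 Definition 1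
(`k`-order contraction `|∧ᵢ w(t, aⁱ)| ≤ e^{-ηt} |∧ᵢ aⁱ|`, i.e. `ω_k` of the transition operator
`≤ e^{-ηt}`) and Proposition 3.

**Contents** (namespace `Literature.Dynamics.Contraction`; `E, F, G` real inner product spaces,
`L : E →L[ℝ] F`).
* `areaDilation L = ω₂(L) := sup {|L x ∧ L y| : ‖x‖ ≤ 1, ‖y‖ ≤ 1}` — Temam's (1.19) for `m = 2`
  (the third member of (1.56)), written with `|u ∧ v| = √(gramArea u v)`; the defining set is
  `areaDilationSet L`.  We allow `L : E → F` between different spaces (Temam: `F = E`), which is what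
  cocycles / quotient maps need and costs nothing.
* `areaDilation_le_opNorm_sq`: `ω₂(L) ≤ ‖L‖²` ((1.20), `ω₂ ≤ ω₁²`); `areaDilation_nonneg`.
* `sqrt_gramArea_map_le`: **`|L x ∧ L y| ≤ ω₂(L) |x ∧ y|` for all `x, y`** ((2.7)–(2.8): the sup of the
  ratio over decomposable 2-vectors is the same number — by a two-vector Gram–Schmidt reduction,
  `exists_orthonormal_gramArea_eq`), its squared form `gramArea_map_le` (Horn's Lemma 2.4 for
  `k = 2`), and conversely `areaDilation_le_of_gramArea_le`: a bound `|L x ∧ L y| ≤ K |x ∧ y|` gives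
  `ω₂(L) ≤ K`; so `ω₂(L)` is the least such `K ≥ 0`.
* `areaDilation_le_of_orthonormal`: it suffices to bound `|L u ∧ L v|` on ORTHONORMAL pairs (the
  reduction used in the proof of Proposition 1.4).
* `areaDilation_comp_le`: **`ω₂(L M) ≤ ω₂(L) ω₂(M)`** (Corollary 1.1 (1.60) / Horn (2.15), `d = 2`),
  `areaDilation_pow_le`: `ω₂(Lⁿ) ≤ ω₂(L)ⁿ`; `areaDilation_smul`: `ω₂(c L) = c² ω₂(L)`;
  `areaDilation_zero`, `areaDilation_id_le`, `areaDilation_id` (`= 1` once `E` has an orthonormal pair).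
* `areaDilation_flow_le_exp`: **the operator form of 2-contraction** — if `Φ t` are bounded solution
  operators of `ẋ = A(t) x` on `[0, T]` and `⟪A(t) u, u⟫ + ⟪A(t) v, v⟫ ≤ κ` for all orthonormal `u, v`
  (the trace / Ky Fan form of `μ₂(A(t)^{[2]}) ≤ κ`, see `GramArea.gramArea_le_mul_exp_of_orthonormal`),
  then `ω₂(Φ t) ≤ e^{κt}` (Wu–Kanevskiy–Margaliot Proposition 3 with Definition 1, `k = 2`; Temam
  (2.45) with a constant bound).

**Not here.**  Singular values: the equalities `ω₂(L) = α₁(L) α₂(L)` and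
`ω₂(L) = ‖Λ² L‖_{ℒ(Λ² E)}` of Proposition 1.4 (they need the spectral theory of `L* L`, resp. a norm on
Mathlib's abstract `⋀[ℝ]^2 E`, which it does not carry); `ω_m` for `m ≥ 3` and the interpolated
`ω_d`, `d ∉ ℕ` ((1.64), K–R (2.4)).  Nothing below is a named fact; everything is proved.

## Mathlib search

`exteriorPower` has no norm / inner product; no singular value function, `ω_d`, or compound-operator
norm in Mathlib or Literature (`lean search 'areaDilation|singularValueFunction|volumeDistortion'`:
nothing relevant).  Used: `Real.sqrt_le_sqrt`, `Real.sqrt_mul`, `Real.sqrt_sq`, `csSup_le`,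
`le_csSup`, `ContinuousLinearMap.le_opNorm`, and from `GramArea.lean`: `gramArea_nonneg`,
`gramArea_smul_left/right`, `gramArea_add_smul_right` (shear invariance), `gramArea_of_inner_eq_zero`,
`exists_eq_add_smul_of_ne_zero`, `gramArea_le_mul_exp_of_orthonormal`.

## References

* R. Temam, *Infinite-Dimensional Dynamical Systems in Mechanics and Physics*, 2nd ed., Applied
  Mathematical Sciences 68, Springer (1997), Ch. V §1.1 (1.16), §1.2.1 (1.17)–(1.24), §1.3
  Proposition 1.4 (1.56), Corollary 1.1 (1.60), §2.1 (2.7)–(2.8), §2.3 (2.45). [Temam1997]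
* N. V. Kuznetsov, V. Reitmann, *Attractor Dimension Estimates for Dynamical Systems: Theory and
  Computation*, Springer (2021), §2.1.2 (2.3)–(2.4), §2.2.2 Lemma 2.4, §2.2.3 Proposition 2.4,
  §6.1. [KuznetsovReitmann2021]
* C. Wu, I. Kanevskiy, M. Margaliot, *k-contraction: theory and applications*, arXiv:2008.10321,
  §3.1 Definition 1, Proposition 3. [WuKanevskiyMargaliot2020]
-/

noncomputable section

open scoped InnerProductSpace
open Set

namespace Literature.Dynamics.Contraction

variable {E F G : Type*} [NormedAddCommGroup E] [InnerProductSpace ℝ E]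
  [NormedAddCommGroup F] [InnerProductSpace ℝ F] [NormedAddCommGroup G] [InnerProductSpace ℝ G]

/-! ### Hadamard's inequality and the two-vector Gram–Schmidt reduction -/

/-- **Hadamard's inequality for 2-volumes**: `|x ∧ y|² ≤ ‖x‖² ‖y‖²`. [cite: Temam1997, Ch. V (1.16)] -/
theorem gramArea_le_norm_sq_mul (x y : E) : gramArea x y ≤ ‖x‖ ^ 2 * ‖y‖ ^ 2 := by
  rw [gramArea_def]
  nlinarith [sq_nonneg ⟪x, y⟫_ℝ]

/-- `|x ∧ y| ≤ ‖x‖ ‖y‖`. [cite: Temam1997, Ch. V (1.16)] -/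
theorem sqrt_gramArea_le_norm_mul (x y : E) : Real.sqrt (gramArea x y) ≤ ‖x‖ * ‖y‖ := by
  calc Real.sqrt (gramArea x y) ≤ Real.sqrt ((‖x‖ * ‖y‖) ^ 2) :=
        Real.sqrt_le_sqrt (by rw [mul_pow]; exact gramArea_le_norm_sq_mul x y)
    _ = ‖x‖ * ‖y‖ := Real.sqrt_sq (by positivity)

/-- **Reduction to an orthonormal pair** (two-vector Gram–Schmidt, as in the proof of Temam's
Proposition 1.4): for any `x, y` and any linear `L`, either both `|x ∧ y|` and `|L x ∧ L y|` vanish, or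
there are an orthonormal pair `u, v` spanning `span {x, y}` and `0 ≤ r ≤ ‖x‖ ‖y‖` with
`|x ∧ y|² = r²` and `|L x ∧ L y|² = r² |L u ∧ L v|²` (namely `y = w + c x`, `w ⟂ x`, `u = x/‖x‖`,
`v = w/‖w‖`, `r = ‖x‖ ‖w‖`). [cite: Temam1997, Ch. V Proposition 1.4] -/
theorem exists_orthonormal_gramArea_eq (L : E →L[ℝ] F) (x y : E) :
    (gramArea x y = 0 ∧ gramArea (L x) (L y) = 0) ∨
      ∃ (u v : E) (r : ℝ), ‖u‖ = 1 ∧ ‖v‖ = 1 ∧ ⟪u, v⟫_ℝ = 0 ∧ 0 ≤ r ∧ r ≤ ‖x‖ * ‖y‖ ∧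
        gramArea x y = r ^ 2 ∧ gramArea (L x) (L y) = r ^ 2 * gramArea (L u) (L v) := by
  by_cases hx : x = 0
  · left
    subst hx
    rw [map_zero, gramArea_zero_left, gramArea_zero_left]
    exact ⟨rfl, rfl⟩
  obtain ⟨w, c, rfl, hxw⟩ := exists_eq_add_smul_of_ne_zero hx y
  by_cases hw : w = 0
  · left
    subst hw
    refine ⟨?_, ?_⟩
    · rw [gramArea_add_smul_right, gramArea_zero_right]
    · rw [map_add, map_smul, gramArea_add_smul_right, map_zero, gramArea_zero_right]
  right
  have hxn : ‖x‖ ≠ 0 := norm_ne_zero_iff.mpr hx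
  have hwn : ‖w‖ ≠ 0 := norm_ne_zero_iff.mpr hw
  refine ⟨‖x‖⁻¹ • x, ‖w‖⁻¹ • w, ‖x‖ * ‖w‖, ?_, ?_, ?_, by positivity, ?_, ?_, ?_⟩
  · rw [norm_smul, norm_inv, norm_norm, inv_mul_cancel₀ hxn]
  · rw [norm_smul, norm_inv, norm_norm, inv_mul_cancel₀ hwn]
  · rw [real_inner_smul_left, real_inner_smul_right, hxw, mul_zero, mul_zero]
  · -- `‖w‖ ≤ ‖w + c x‖` since `w ⟂ x`
    refine mul_le_mul_of_nonneg_left ?_ (norm_nonneg x)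
    have hwx : ⟪w, x⟫_ℝ = 0 := (real_inner_comm x w).trans hxw
    have h2 : ‖w + c • x‖ ^ 2 = ‖w‖ ^ 2 + (c * ‖x‖) ^ 2 := by
      rw [norm_add_sq_real, real_inner_smul_right, hwx, mul_zero, mul_zero, add_zero, norm_smul,
        Real.norm_eq_abs, mul_pow, mul_pow, sq_abs]
    refine (pow_le_pow_iff_left₀ (norm_nonneg w) (norm_nonneg _) two_ne_zero).mp ?_
    rw [h2]
    nlinarith [sq_nonneg (c * ‖x‖)]
  · rw [gramArea_add_smul_right, gramArea_of_inner_eq_zero hxw]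
    ring
  · rw [map_add, map_smul, gramArea_add_smul_right, map_smul, map_smul, gramArea_smul_left,
      gramArea_smul_right, inv_pow, inv_pow, mul_pow]
    field_simp

/-! ### The area dilation `ω₂(L)` -/

/-- The set of 2-volumes `|L x ∧ L y|` of images of pairs from the unit ball, `‖x‖ ≤ 1`, `‖y‖ ≤ 1`,
whose supremum is `ω₂(L)`. [cite: Temam1997, Ch. V (1.19)] -/
def areaDilationSet (L : E →L[ℝ] F) : Set ℝ :=
  (fun p : E × E => Real.sqrt (gramArea (L p.1) (L p.2))) '' {p : E × E | ‖p.1‖ ≤ 1 ∧ ‖p.2‖ ≤ 1}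

/-- **The area dilation `ω₂(L) = sup {|L x ∧ L y| : ‖x‖ ≤ 1, ‖y‖ ≤ 1}`** of a bounded linear map
between real inner product spaces: the norm of `Λ² L : (x, y) ↦ L x ∧ L y` as a bilinear operator into
`Λ² F` (Temam (1.19), `m = 2`), equal by Temam's Proposition 1.4 to the operator norm of `Λ² L` on
`Λ² E` and to the product `α₁(L) α₂(L)` of the two largest singular values (Kuznetsov–Reitmann's
singular value function `ω₂`); it is the largest factor by which `L` dilates 2-dimensional areas
(`sqrt_gramArea_map_le`, Temam (2.7)–(2.8)).  A linear cocycle is *2-contracting* when `ω₂ ≤ c e^{-ηt}`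
along it. [cite: Temam1997, Ch. V (1.19), (1.24), Proposition 1.4]
[cite: KuznetsovReitmann2021, §2.1.2 (2.3)] -/
def areaDilation (L : E →L[ℝ] F) : ℝ :=
  sSup (areaDilationSet L)

/-- Unfolding lemma for `areaDilation`. [folklore] -/
theorem areaDilation_def (L : E →L[ℝ] F) : areaDilation L = sSup (areaDilationSet L) := rfl

/-- Membership in the defining set. [folklore] -/
theorem mem_areaDilationSet {L : E →L[ℝ] F} {x y : E} (hx : ‖x‖ ≤ 1) (hy : ‖y‖ ≤ 1) :
    Real.sqrt (gramArea (L x) (L y)) ∈ areaDilationSet L :=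
  ⟨(x, y), ⟨hx, hy⟩, rfl⟩

/-- `0 = |L 0 ∧ L 0|` belongs to the defining set. [folklore] -/
theorem zero_mem_areaDilationSet (L : E →L[ℝ] F) : (0 : ℝ) ∈ areaDilationSet L := by
  have h := mem_areaDilationSet (L := L) (x := 0) (y := 0) (by simp) (by simp)
  rwa [map_zero, gramArea_zero_left, Real.sqrt_zero] at h

/-- The defining set is nonempty. [folklore] -/
theorem areaDilationSet_nonempty (L : E →L[ℝ] F) : (areaDilationSet L).Nonempty :=
  ⟨0, zero_mem_areaDilationSet L⟩

/-- Every `|L x ∧ L y|` with `‖x‖, ‖y‖ ≤ 1` is at most `‖L‖²` ((1.18): `|Lx ∧ Ly| ≤ |Lx| |Ly|`).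
[cite: Temam1997, Ch. V (1.18)–(1.20)] -/
theorem le_opNorm_sq_of_mem_areaDilationSet {L : E →L[ℝ] F} {r : ℝ} (hr : r ∈ areaDilationSet L) :
    r ≤ ‖L‖ ^ 2 := by
  obtain ⟨⟨x, y⟩, ⟨hx, hy⟩, rfl⟩ := hr
  dsimp only at hx hy ⊢
  calc Real.sqrt (gramArea (L x) (L y)) ≤ ‖L x‖ * ‖L y‖ := sqrt_gramArea_le_norm_mul _ _
    _ ≤ ‖L‖ * ‖x‖ * (‖L‖ * ‖y‖) :=
        mul_le_mul (L.le_opNorm x) (L.le_opNorm y) (norm_nonneg _) (by positivity)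
    _ ≤ ‖L‖ * 1 * (‖L‖ * 1) := by gcongr
    _ = ‖L‖ ^ 2 := by ring

/-- The defining set is bounded above (by `‖L‖²`). [cite: Temam1997, Ch. V (1.20)] -/
theorem bddAbove_areaDilationSet (L : E →L[ℝ] F) : BddAbove (areaDilationSet L) :=
  ⟨‖L‖ ^ 2, fun _ hr => le_opNorm_sq_of_mem_areaDilationSet hr⟩

/-- **`ω₂(L) ≤ ‖L‖²`** (`‖Λ^m L‖ ≤ ‖L‖^m`, i.e. `ω₂ ≤ ω₁²`). [cite: Temam1997, Ch. V (1.20)] -/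
theorem areaDilation_le_opNorm_sq (L : E →L[ℝ] F) : areaDilation L ≤ ‖L‖ ^ 2 :=
  csSup_le (areaDilationSet_nonempty L) fun _ hr => le_opNorm_sq_of_mem_areaDilationSet hr

/-- `0 ≤ ω₂(L)`. [folklore] -/
theorem areaDilation_nonneg (L : E →L[ℝ] F) : 0 ≤ areaDilation L :=
  le_csSup (bddAbove_areaDilationSet L) (zero_mem_areaDilationSet L)

/-- **The defining inequality on the unit ball**: `|L x ∧ L y| ≤ ω₂(L)` for `‖x‖, ‖y‖ ≤ 1`.
[cite: Temam1997, Ch. V (1.19)] -/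
theorem sqrt_gramArea_le_areaDilation (L : E →L[ℝ] F) {x y : E} (hx : ‖x‖ ≤ 1) (hy : ‖y‖ ≤ 1) :
    Real.sqrt (gramArea (L x) (L y)) ≤ areaDilation L :=
  le_csSup (bddAbove_areaDilationSet L) (mem_areaDilationSet hx hy)

/-- **Criterion**: if `|L x ∧ L y| ≤ C` whenever `‖x‖, ‖y‖ ≤ 1`, then `ω₂(L) ≤ C`.
[cite: Temam1997, Ch. V (1.19)] -/
theorem areaDilation_le {L : E →L[ℝ] F} {C : ℝ}
    (h : ∀ x y : E, ‖x‖ ≤ 1 → ‖y‖ ≤ 1 → Real.sqrt (gramArea (L x) (L y)) ≤ C) :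
    areaDilation L ≤ C := by
  refine csSup_le (areaDilationSet_nonempty L) ?_
  rintro _ ⟨⟨x, y⟩, ⟨hx, hy⟩, rfl⟩
  exact h x y hx hy

/-- **`ω₂(L)` is the largest dilation of areas: `|L x ∧ L y| ≤ ω₂(L) |x ∧ y|` for all `x, y`** — the
supremum of the ratio over decomposable 2-vectors (Temam (2.7)) is the number (1.19), by reduction
to an orthonormal pair in `span {x, y}`. [cite: Temam1997, Ch. V §2.1 (2.7)–(2.8), Proposition 1.4] -/
theorem sqrt_gramArea_map_le (L : E →L[ℝ] F) (x y : E) :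
    Real.sqrt (gramArea (L x) (L y)) ≤ areaDilation L * Real.sqrt (gramArea x y) := by
  rcases exists_orthonormal_gramArea_eq L x y with
    ⟨hxy, hL⟩ | ⟨u, v, r, hu, hv, -, hr, -, hxy, hL⟩
  · rw [hL, hxy, Real.sqrt_zero, mul_zero]
  · rw [hL, hxy, Real.sqrt_mul (sq_nonneg r), Real.sqrt_sq hr, mul_comm (areaDilation L) r]
    exact mul_le_mul_of_nonneg_left (sqrt_gramArea_le_areaDilation L hu.le hv.le) hr

/-- **Horn's inequality in Gram-determinant form, `k = 2`**: `|L x ∧ L y|² ≤ ω₂(L)² |x ∧ y|²`.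
[cite: KuznetsovReitmann2021, §2.2.2 Lemma 2.4] [cite: Temam1997, Ch. V (2.7)–(2.8)] -/
theorem gramArea_map_le (L : E →L[ℝ] F) (x y : E) :
    gramArea (L x) (L y) ≤ areaDilation L ^ 2 * gramArea x y := by
  have h := sqrt_gramArea_map_le L x y
  rw [← Real.sqrt_sq (areaDilation_nonneg L), ← Real.sqrt_mul (sq_nonneg _)] at h
  exact (Real.sqrt_le_sqrt_iff (mul_nonneg (sq_nonneg _) (gramArea_nonneg _ _))).mp h

/-- **Converse criterion**: a bound `|L x ∧ L y|² ≤ K² |x ∧ y|²` for all `x, y` (with `K ≥ 0`) gives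
`ω₂(L) ≤ K`; with `gramArea_map_le`, `ω₂(L)` is the least such `K`.
[cite: Temam1997, Ch. V §2.1 (2.7)–(2.8)] -/
theorem areaDilation_le_of_gramArea_le {L : E →L[ℝ] F} {K : ℝ} (hK : 0 ≤ K)
    (h : ∀ x y : E, gramArea (L x) (L y) ≤ K ^ 2 * gramArea x y) : areaDilation L ≤ K := by
  refine areaDilation_le fun x y hx hy => ?_
  have hxy1 : ‖x‖ * ‖y‖ ≤ 1 := by nlinarith [norm_nonneg x, norm_nonneg y]
  have hg1 : gramArea x y ≤ 1 := by
    refine (gramArea_le_norm_sq_mul x y).trans ?_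
    rw [← mul_pow]
    exact pow_le_one₀ (by positivity) hxy1
  calc Real.sqrt (gramArea (L x) (L y)) ≤ Real.sqrt (K ^ 2 * 1) :=
        Real.sqrt_le_sqrt ((h x y).trans (mul_le_mul_of_nonneg_left hg1 (sq_nonneg K)))
    _ = K := by rw [mul_one, Real.sqrt_sq hK]

/-- **Orthonormal pairs suffice**: if `|L u ∧ L v| ≤ C` for every orthonormal pair `u, v` (and
`0 ≤ C`, needed when `E` has no orthonormal pair), then `ω₂(L) ≤ C` — the reduction in the proof of
Proposition 1.4 (`sup` over orthonormal families). [cite: Temam1997, Ch. V Proposition 1.4] -/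
theorem areaDilation_le_of_orthonormal {L : E →L[ℝ] F} {C : ℝ} (hC : 0 ≤ C)
    (h : ∀ u v : E, ‖u‖ = 1 → ‖v‖ = 1 → ⟪u, v⟫_ℝ = 0 → Real.sqrt (gramArea (L u) (L v)) ≤ C) :
    areaDilation L ≤ C := by
  refine areaDilation_le fun x y hx hy => ?_
  rcases exists_orthonormal_gramArea_eq L x y with
    ⟨-, hL⟩ | ⟨u, v, r, hu, hv, huv, hr, hrle, -, hL⟩
  · rw [hL, Real.sqrt_zero]
    exact hC
  · rw [hL, Real.sqrt_mul (sq_nonneg r), Real.sqrt_sq hr]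
    have hr1 : r ≤ 1 := hrle.trans (by nlinarith [norm_nonneg x, norm_nonneg y])
    calc r * Real.sqrt (gramArea (L u) (L v)) ≤ 1 * C :=
          mul_le_mul hr1 (h u v hu hv huv) (Real.sqrt_nonneg _) zero_le_one
      _ = C := one_mul C

/-! ### Algebra of `ω₂`: composition, powers, scalars, `0`, `id` -/

/-- **Submultiplicativity `ω₂(L ∘ M) ≤ ω₂(L) ω₂(M)`** (Horn's inequality for `d = 2`).
[cite: Temam1997, Ch. V Corollary 1.1 (1.60)] [cite: KuznetsovReitmann2021, §2.2.3 Proposition 2.4] -/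
theorem areaDilation_comp_le (L : F →L[ℝ] G) (M : E →L[ℝ] F) :
    areaDilation (L.comp M) ≤ areaDilation L * areaDilation M := by
  refine areaDilation_le fun x y hx hy => ?_
  rw [ContinuousLinearMap.comp_apply, ContinuousLinearMap.comp_apply]
  calc Real.sqrt (gramArea (L (M x)) (L (M y)))
        ≤ areaDilation L * Real.sqrt (gramArea (M x) (M y)) := sqrt_gramArea_map_le L (M x) (M y)
    _ ≤ areaDilation L * areaDilation M :=
        mul_le_mul_of_nonneg_left (sqrt_gramArea_le_areaDilation M hx hy) (areaDilation_nonneg L)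

/-- `ω₂(id) ≤ 1`. [folklore] -/
theorem areaDilation_id_le : areaDilation (ContinuousLinearMap.id ℝ E) ≤ 1 := by
  refine areaDilation_le fun x y hx hy => ?_
  rw [ContinuousLinearMap.coe_id', id_eq, id_eq]
  calc Real.sqrt (gramArea x y) ≤ ‖x‖ * ‖y‖ := sqrt_gramArea_le_norm_mul x y
    _ ≤ 1 * 1 := mul_le_mul hx hy (norm_nonneg _) zero_le_one
    _ = 1 := one_mul 1

/-- `ω₂(id) = 1` as soon as `E` contains an orthonormal pair (i.e. `dim E ≥ 2`). [folklore] -/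
theorem areaDilation_id (h : ∃ u v : E, ‖u‖ = 1 ∧ ‖v‖ = 1 ∧ ⟪u, v⟫_ℝ = 0) :
    areaDilation (ContinuousLinearMap.id ℝ E) = 1 := by
  refine le_antisymm areaDilation_id_le ?_
  obtain ⟨u, v, hu, hv, huv⟩ := h
  have h1 := sqrt_gramArea_le_areaDilation (ContinuousLinearMap.id ℝ E) hu.le hv.le
  rwa [ContinuousLinearMap.coe_id', id_eq, id_eq, gramArea_of_inner_eq_zero huv, hu, hv, one_pow,
    mul_one, Real.sqrt_one] at h1

/-- **`ω₂(Lⁿ) ≤ ω₂(L)ⁿ`** (iterating Corollary 1.1; the discrete-time volume bound).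
[cite: Temam1997, Ch. V §2.3, footnote to (2.45)] -/
theorem areaDilation_pow_le (L : E →L[ℝ] E) (n : ℕ) : areaDilation (L ^ n) ≤ areaDilation L ^ n := by
  induction n with
  | zero =>
      rw [pow_zero, pow_zero, ContinuousLinearMap.one_def]
      exact areaDilation_id_le
  | succ n ih =>
      rw [pow_succ, pow_succ, ContinuousLinearMap.mul_def]
      exact (areaDilation_comp_le _ _).trans
        (mul_le_mul_of_nonneg_right ih (areaDilation_nonneg L))

/-- `ω₂(c L) ≤ c² ω₂(L)`. [folklore] -/
theorem areaDilation_smul_le (c : ℝ) (L : E →L[ℝ] F) :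
    areaDilation (c • L) ≤ c ^ 2 * areaDilation L := by
  refine areaDilation_le fun x y hx hy => ?_
  rw [show (c • L) x = c • L x from rfl, show (c • L) y = c • L y from rfl, gramArea_smul_left,
    gramArea_smul_right, ← mul_assoc, ← sq, Real.sqrt_mul (sq_nonneg _), Real.sqrt_sq (sq_nonneg c)]
  exact mul_le_mul_of_nonneg_left (sqrt_gramArea_le_areaDilation L hx hy) (sq_nonneg c)

/-- **Homogeneity of degree two: `ω₂(c L) = c² ω₂(L)`** (`α_i(cL) = |c| α_i(L)`). [folklore] -/
theorem areaDilation_smul (c : ℝ) (L : E →L[ℝ] F) :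
    areaDilation (c • L) = c ^ 2 * areaDilation L := by
  refine le_antisymm (areaDilation_smul_le c L) ?_
  by_cases hc : c = 0
  · subst hc
    rw [zero_pow two_ne_zero, zero_mul, zero_smul]
    exact areaDilation_nonneg _
  · have h := areaDilation_smul_le c⁻¹ (c • L)
    rw [smul_smul, inv_mul_cancel₀ hc, one_smul] at h
    have hc2 : 0 < c ^ 2 := by positivity
    calc c ^ 2 * areaDilation L ≤ c ^ 2 * (c⁻¹ ^ 2 * areaDilation (c • L)) :=
          mul_le_mul_of_nonneg_left h hc2.le
      _ = areaDilation (c • L) := by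
          rw [← mul_assoc, inv_pow, mul_inv_cancel₀ hc2.ne', one_mul]

/-- `ω₂(0) = 0`. [folklore] -/
@[simp] theorem areaDilation_zero : areaDilation (0 : E →L[ℝ] F) = 0 :=
  le_antisymm ((areaDilation_le_opNorm_sq _).trans (by rw [norm_zero, sq, mul_zero]))
    (areaDilation_nonneg _)

/-! ### 2-contraction of a linear flow in terms of `ω₂` -/

/-- **Operator form of 2-contraction.**  Let `Φ t : E →L[ℝ] E`, `t ∈ [0, T]`, be solution operators of
`ẋ = A(t) x` (`Φ 0 = id`, `t ↦ Φ t x₀` continuous on `[0, T]` with right derivative `A(t) (Φ t x₀)`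
on `[0, T)`), and suppose the trace condition `⟪A(t) u, u⟫ + ⟪A(t) v, v⟫ ≤ κ` for all orthonormal
`u, v` (the Ky Fan form of `μ₂(A(t)^{[2]}) ≤ κ`).  Then `ω₂(Φ t) ≤ e^{κt}` on `[0, T]` — with `κ = -η < 0`
this is `2`-order contraction in the sense of Wu–Kanevskiy–Margaliot.
[cite: WuKanevskiyMargaliot2020, §3.1 Definition 1, Proposition 3] [cite: Temam1997, Ch. V (2.45)] -/
theorem areaDilation_flow_le_exp {A : ℝ → E →ₗ[ℝ] E} {Φ : ℝ → E →L[ℝ] E} {κ T : ℝ}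
    (h0 : ∀ x₀ : E, Φ 0 x₀ = x₀)
    (hc : ∀ x₀ : E, ContinuousOn (fun t => Φ t x₀) (Icc 0 T))
    (hd : ∀ x₀ : E, ∀ t ∈ Ico 0 T, HasDerivWithinAt (fun s => Φ s x₀) (A t (Φ t x₀)) (Ici t) t)
    (hA : ∀ t ∈ Ico 0 T, ∀ u v : E, ‖u‖ = 1 → ‖v‖ = 1 → ⟪u, v⟫_ℝ = 0 →
      ⟪A t u, u⟫_ℝ + ⟪A t v, v⟫_ℝ ≤ κ) :
    ∀ t ∈ Icc 0 T, areaDilation (Φ t) ≤ Real.exp (κ * t) := by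
  intro t ht
  refine areaDilation_le_of_gramArea_le (Real.exp_pos _).le fun x₀ y₀ => ?_
  have h := gramArea_le_mul_exp_of_orthonormal (hc x₀) (hc y₀) (hd x₀) (hd y₀) hA t ht
  have hexp : Real.exp (2 * κ * t) = Real.exp (κ * t) ^ 2 := by
    rw [← Real.exp_nat_mul]
    congr 1
    push_cast
    ring
  rw [h0, h0, hexp] at h
  linarith

end Literature.Dynamics.Contraction
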